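import Summits.NavierStokesRegularity.NavierStokesRegularity.Theorems.AdaptedFrequencyAdaptedKernelExistsPackagingEnvelope
import Summits.NavierStokesRegularity.NavierStokesRegularity.Theorems.AdaptedFrequencyAdaptedKernelExistsPrekernelDecayBox

/-!
# Crux `AdaptedFrequencyConverges` (stmt-NavierStokesRegularity-10493), line
  `cloud-frame-effective-tsai`: the GAUSSIAN ENVELOPE for STUB `stub_blockSolver`

Helper file (lands `--supports stmt-NavierStokesRegularity-10493`).  Gaussian algebra turning
the upper comparison of the tree (`prekernel_comparison`:
`g(t, x) ≤ ∫ g(Ta, z) k₊(ν(Ta−t) + σ₀, x − z) dz + δ`, `k₊ = driftKernel 1 (B/ν)`,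
`σ₀ ∈ (0, ν(Ta−t)]`, every `δ > 0`) into a Gaussian envelope `g ≤ A e^{−‖x‖²/a}` on the slab
`Ioo ta T`, when the top slice is the free solution, `g = F` on `Ico Ta T`, and the free solution
is dominated by heat kernels of age at least one, `0 ≤ F(t, ·) ≤ C_f G_{ν(T−t)+1}`
(`G_σ = heatKernel σ`).  The constants `A`, `a` depend on `(ν, B, C_f, T − ta)` only — NOT on
`Ta` — which is what the passage to the limit `Ta ↑ T` of the block solver needs
(`envelope_of_comparison`).  Ingredients (all from `…AdaptedKernelExistsPackagingEnvelope` and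
`…PrekernelDecayBox`): `k₊(σ, y) ≤ e^{4A²σ+9A√σ} 2^{3/2} G_{2σ}(y)`, the semigroup law
`∫ G_p(z) G_q(x − z) dz = G_{p+q}(x)`, and the monotonicity of `G_σ` in the age on `[1, p_max]`.
-/

noncomputable section

open MeasureTheory Set Filter Topology Metric Function Real
open scoped Laplacian ContDiff
open Literature.Analysis.FluidPDE Literature.Analysis.UnboundedOperators
open Summit.NavierStokesRegularity.NavierStokesRegularity.Theorems.AdaptedKernelExists.NashEntropyLastBlock

namespace Summit.NavierStokesRegularity.NavierStokesRegularity.Theorems.AdaptedFrequencyConverges.CloudFrameEffectiveTsai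

/-- **The convolution bound**: for `0 ≤ h ≤ C_f G_p`, `A ≥ 0`, `0 < σ ≤ σ₁`,
`∫ h(z) k₊(σ, x − z) dz ≤ C_f e^{4A²σ₁ + 9A√σ₁} 2^{3/2} G_{p+2σ}(x)`. -/
theorem envelope_integral_le {A σ σ₁ p Cf : ℝ} {h : EuclideanSpace ℝ (Fin 3) → ℝ}
    (hA : 0 ≤ A) (hσ : 0 < σ) (hσ₁ : σ ≤ σ₁) (hp : 0 < p)
    (hh0 : ∀ z, 0 ≤ h z) (hh : ∀ z, h z ≤ Cf * heatKernel p z) (x : EuclideanSpace ℝ (Fin 3)) :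
    ∫ z, h z * driftKernel 1 A σ (x - z) ≤
      Cf * (Real.exp (4 * A ^ 2 * σ₁ + 9 * A * Real.sqrt σ₁) * (2:ℝ) ^ ((3:ℝ) / 2)) *
        heatKernel (p + 2 * σ) x := by
  set C : ℝ := Real.exp (4 * A ^ 2 * σ₁ + 9 * A * Real.sqrt σ₁) * (2:ℝ) ^ ((3:ℝ) / 2) with hC
  have hC0 : 0 ≤ C := by rw [hC]; positivity
  have hCf : 0 ≤ Cf := by
    have h1 := (hh0 0).trans (hh 0)
    exact nonneg_of_mul_nonneg_left h1 (heatKernel_pos hp 0)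
  -- pointwise bound of the integrand
  have hpt : ∀ z, h z * driftKernel 1 A σ (x - z) ≤
      Cf * C * (heatKernel p (z - 0) * heatKernel (2 * σ) (x - z)) := by
    intro z
    have hk := (kernelPackaging_driftKernel_le hA hσ (x - z)).trans
      (mul_le_mul_of_nonneg_right (kernelPackaging_tilt_mono hA hσ.le hσ₁)
        (mul_nonneg (by positivity) (heatKernel_pos (by positivity) _).le))
    rw [sub_zero]
    calc h z * driftKernel 1 A σ (x - z)
        ≤ (Cf * heatKernel p z) * (C * heatKernel (2 * σ) (x - z)) :=
          mul_le_mul (hh z) (by rw [hC, mul_assoc]; exact hk) (driftKernel_pos 1 A hσ _).le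
            (mul_nonneg hCf (heatKernel_pos hp _).le)
      _ = _ := by ring
  -- integrability of the majorant
  have hmaj : Integrable fun z => Cf * C * (heatKernel p (z - 0) * heatKernel (2 * σ) (x - z)) := by
    refine Integrable.const_mul ?_ (Cf * C)
    have h1 : Integrable fun z : EuclideanSpace ℝ (Fin 3) => heatKernel p (z - 0) :=
      (integrable_heatKernel_holds hp).comp_sub_right 0
    have h2 : Continuous fun z : EuclideanSpace ℝ (Fin 3) => heatKernel (2 * σ) (x - z) :=
      (continuous_heatKernel _).comp (continuous_const.sub continuous_id)
    refine h1.mul_bdd (c := (4 * π * (2 * σ)) ^ (-((Module.finrank ℝ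
      (EuclideanSpace ℝ (Fin 3)) : ℝ)) / 2)) h2.aestronglyMeasurable
      (Eventually.of_forall fun z => ?_)
    rw [Real.norm_of_nonneg (heatKernel_pos (by positivity) _).le]
    exact heatKernel_le (by positivity) _
  calc ∫ z, h z * driftKernel 1 A σ (x - z)
      ≤ ∫ z, Cf * C * (heatKernel p (z - 0) * heatKernel (2 * σ) (x - z)) :=
        integral_mono_of_nonneg (Eventually.of_forall fun z => mul_nonneg (hh0 z)
          (driftKernel_pos 1 A hσ _).le) hmaj (Eventually.of_forall hpt)
    _ = Cf * C * heatKernel (p + 2 * σ) x := by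
        rw [integral_const_mul, kernelPackaging_integral_heatKernel_mul_heatKernel hp
          (by positivity) x 0, sub_zero]

/-- **Gaussian envelope, uniform in the top time.**  For `ν > 0`, `B ≥ 0`, `C_f ≥ 0` and
`ta < T` there are `A` and `a > 0` such that: whenever `ta < Ta < T`, `g = F` on `Ico Ta T`,
`0 ≤ F(t, ·) ≤ C_f G_{ν(T−t)+1}` on `Ico ta T`, and `g` obeys the upper comparison with top slice
`g(Ta)` and drift bound `B/ν` on `Ioo ta Ta`, then `g(t, x) ≤ A e^{−‖x‖²/a}` on `Ioo ta T`. -/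
theorem envelope_of_comparison {ν ta T B Cf : ℝ} (hν : 0 < ν) (hB : 0 ≤ B) (hCf : 0 ≤ Cf)
    (htaT : ta < T) :
    ∃ A a : ℝ, 0 < a ∧ ∀ (Ta : ℝ) (g F : ℝ → EuclideanSpace ℝ (Fin 3) → ℝ), ta < Ta → Ta < T →
      (∀ t ∈ Ico Ta T, g t = F t) →
      (∀ t ∈ Ico ta T, ∀ x, F t x ≤ Cf * heatKernel (ν * (T - t) + 1) x) →
      (∀ t ∈ Ico ta T, ∀ x, 0 ≤ F t x) →
      (∀ t ∈ Ioo ta Ta, ∀ x, ∀ δ : ℝ, 0 < δ → ∃ σ₀ : ℝ, 0 < σ₀ ∧ σ₀ ≤ ν * (Ta - t) ∧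
        g t x ≤ (∫ z, g Ta z * driftKernel 1 (B / ν) (ν * (Ta - t) + σ₀) (x - z)) + δ) →
      ∀ t ∈ Ioo ta T, ∀ x, g t x ≤ A * Real.exp (-‖x‖ ^ 2 / a) := by
  -- the constants
  set Ad : ℝ := B / ν with hAd
  have hAd0 : 0 ≤ Ad := by rw [hAd]; positivity
  have hTta : 0 < T - ta := sub_pos.2 htaT
  set σ₁ : ℝ := 2 * (ν * (T - ta)) with hσ₁
  have hσ₁0 : 0 < σ₁ := by rw [hσ₁]; positivity
  set pmax : ℝ := 1 + ν * (T - ta) + 2 * σ₁ with hpmax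
  have hpmax1 : 1 ≤ pmax := by rw [hpmax]; nlinarith
  have hpmax0 : 0 < pmax := by linarith
  set C : ℝ := Real.exp (4 * Ad ^ 2 * σ₁ + 9 * Ad * Real.sqrt σ₁) * (2:ℝ) ^ ((3:ℝ) / 2) with hC
  have hC1 : 1 ≤ C := by
    rw [hC]
    exact one_le_mul_of_one_le_of_one_le (Real.one_le_exp (by positivity))
      (Real.one_le_rpow (by norm_num) (by norm_num))
  have hC0 : 0 ≤ C := zero_le_one.trans hC1
  set K : ℝ := (4 * π * 1) ^ (-(Module.finrank ℝ (EuclideanSpace ℝ (Fin 3)) : ℝ) / 2) /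
    (4 * π * pmax) ^ (-(Module.finrank ℝ (EuclideanSpace ℝ (Fin 3)) : ℝ) / 2) with hK
  have hK0 : 0 ≤ K := by
    rw [hK]
    exact div_nonneg (Real.rpow_nonneg (by positivity) _) (Real.rpow_nonneg (by positivity) _)
  set c₀ : ℝ := (4 * π * pmax) ^ (-(3:ℝ) / 2) with hc₀
  refine ⟨Cf * C * K * c₀, 4 * pmax, by positivity, ?_⟩
  intro Ta g F hta hTa hΓ hFle hF0 hcomp t ht x
  -- the target Gaussian and the age comparison
  have hGmax : heatKernel pmax x = c₀ * Real.exp (-‖x‖ ^ 2 / (4 * pmax)) := by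
    simp only [heatKernel, finrank_euclideanSpace_fin, Nat.cast_ofNat, hc₀]
  have hage : ∀ q : ℝ, 1 ≤ q → q ≤ pmax → heatKernel q x ≤ K * heatKernel pmax x := by
    intro q h1 h2
    rw [hK]
    exact prekernel_heatKernel_le one_pos h1 h2 x
  have hfinal : ∀ q : ℝ, 1 ≤ q → q ≤ pmax →
      Cf * C * heatKernel q x ≤ Cf * C * K * c₀ * Real.exp (-‖x‖ ^ 2 / (4 * pmax)) := by
    intro q h1 h2
    calc Cf * C * heatKernel q x ≤ Cf * C * (K * heatKernel pmax x) :=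
          mul_le_mul_of_nonneg_left (hage q h1 h2) (by positivity)
      _ = Cf * C * K * c₀ * Real.exp (-‖x‖ ^ 2 / (4 * pmax)) := by rw [hGmax]; ring
  rcases lt_or_ge t Ta with htT | htT
  · -- interior times: the comparison
    refine le_of_forall_pos_le_add fun δ hδ => ?_
    obtain ⟨σ₀, hσ₀, hσ₀le, hle⟩ := hcomp t ⟨ht.1, htT⟩ x δ hδ
    set σ : ℝ := ν * (Ta - t) + σ₀ with hσ
    set p : ℝ := ν * (T - Ta) + 1 with hp
    have hTat : 0 < Ta - t := sub_pos.2 htT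
    have hp0 : 0 < p := by rw [hp]; have := mul_pos hν (sub_pos.2 hTa); linarith
    have hσ0 : 0 < σ := by rw [hσ]; positivity
    have hσle : σ ≤ σ₁ := by
      rw [hσ, hσ₁]
      nlinarith [mul_le_mul_of_nonneg_left (show Ta - t ≤ T - ta by linarith [ht.1]) hν.le]
    have hTaI : Ta ∈ Ico ta T := ⟨hta.le, hTa⟩
    have htop : ∀ z, g Ta z = F Ta z := fun z => by rw [hΓ Ta ⟨le_rfl, hTa⟩]
    have hh0 : ∀ z, 0 ≤ g Ta z := fun z => by rw [htop z]; exact hF0 Ta hTaI z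
    have hh : ∀ z, g Ta z ≤ Cf * heatKernel p z := fun z => by
      rw [htop z, hp]; exact hFle Ta hTaI z
    have hI := envelope_integral_le hAd0 hσ0 hσle hp0 hh0 hh x
    have hq1 : 1 ≤ p + 2 * σ := by
      rw [hp]; have := mul_nonneg hν.le (sub_pos.2 hTa).le; nlinarith
    have hq2 : p + 2 * σ ≤ pmax := by
      rw [hp, hpmax]
      nlinarith [mul_le_mul_of_nonneg_left (show T - Ta ≤ T - ta by linarith) hν.le]
    calc g t x ≤ (∫ z, g Ta z * driftKernel 1 Ad σ (x - z)) + δ := hle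
      _ ≤ Cf * C * heatKernel (p + 2 * σ) x + δ := by rw [hC]; linarith [hI]
      _ ≤ Cf * C * K * c₀ * Real.exp (-‖x‖ ^ 2 / (4 * pmax)) + δ := by
          linarith [hfinal (p + 2 * σ) hq1 hq2]
  · -- late times: `g = F`
    have htI : t ∈ Ico ta T := ⟨ht.1.le, ht.2⟩
    have hgt : g t x = F t x := by rw [hΓ t ⟨htT, ht.2⟩]
    have hq1 : 1 ≤ ν * (T - t) + 1 := by
      have := mul_nonneg hν.le (sub_pos.2 ht.2).le; linarith
    have hq2 : ν * (T - t) + 1 ≤ pmax := by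
      rw [hpmax]
      nlinarith [mul_le_mul_of_nonneg_left (show T - t ≤ T - ta by linarith [ht.1]) hν.le]
    have hG0 : 0 ≤ heatKernel (ν * (T - t) + 1) x := (heatKernel_pos (by linarith) _).le
    calc g t x = F t x := hgt
      _ ≤ Cf * heatKernel (ν * (T - t) + 1) x := hFle t htI x
      _ ≤ Cf * C * heatKernel (ν * (T - t) + 1) x := by
          rw [mul_assoc]
          exact mul_le_mul_of_nonneg_left (le_mul_of_one_le_left hG0 hC1) hCf
      _ ≤ Cf * C * K * c₀ * Real.exp (-‖x‖ ^ 2 / (4 * pmax)) := hfinal _ hq1 hq2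

/-! ### Registered sub-goal -/

/-- **Registered sub-goal `stub_blockSolver_envelope`** (closed form of `envelope_of_comparison`,
sub-goal of STUB `stub_blockSolver`): the Gaussian envelope, uniform in the top time, from the
upper comparison with a top slice dominated by heat kernels of age at least one. -/
theorem stub_blockSolver_envelope :
    ∀ (ν ta T B Cf : ℝ), 0 < ν → 0 ≤ B → 0 ≤ Cf → ta < T → ∃ A a : ℝ, 0 < a ∧ ∀ (Ta : ℝ) (g F : ℝ → (EuclideanSpace ℝ (Fin 3)) → ℝ), ta < Ta → Ta < T → (∀ t ∈ Ico Ta T, g t = F t) → (∀ t ∈ Ico ta T, ∀ x, F t x ≤ Cf * Literature.Analysis.UnboundedOperators.heatKernel (ν * (T - t) + 1) x) → (∀ t ∈ Ico ta T, ∀ x, 0 ≤ F t x) → (∀ t ∈ Ioo ta Ta, ∀ x, ∀ δ : ℝ, 0 < δ → ∃ σ₀ : ℝ, 0 < σ₀ ∧ σ₀ ≤ ν * (Ta - t) ∧ g t x ≤ (∫ z, g Ta z * driftKernel 1 (B / ν) (ν * (Ta - t) + σ₀) (x - z)) + δ) → ∀ t ∈ Ioo ta T, ∀ x, g t x ≤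 A * Real.exp (-‖x‖ ^ 2 / a) :=
  fun _ _ _ _ _ hν hB hCf htaT => envelope_of_comparison hν hB hCf htaT

end Summit.NavierStokesRegularity.NavierStokesRegularity.Theorems.AdaptedFrequencyConverges.CloudFrameEffectiveTsai

end
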